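import Summits.QuantumFields.YangMills.Theorems.AllWindowsColdBoxBoxHighLineQuadFormCum3Wick

/-!
# `ConnectedThreePoint`, ODD part (U5-BLOCKERS §2, lift L2 / ASSEMBLY-U5 §3): one Wick-ordered pair against two trace-free cubic forms of a
# centred Gaussian process — only the 36 pairings with NO intra-triple line survive

Width seat `ym-line-sfw-p2-w3` (g41), cell ym-idea-1; U5 prep, helper-grade.  The odd×odd part of `f′(0) = κ₃,₀(c₀, c_T; U)` (ASSEMBLY-S5 (e4)) is
`E₀[c₀^{odd}·L̃_T·V₃] + (0 ↔ T)`: `L̃_T` a CENTRED QUADRATIC form (a sum of Wick-ordered pairs `X_bX_b' − C_bb'`), `c₀^{odd}`, `V₃ = β·Σ_p tripleForm_p` CUBIC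
forms whose tensors are trace-free in every pair of slots against the colour-diagonal propagator (ε-structure, as in ✓`CubicChaos.integral_cubicForm_sq`).
S5 bounded it by a sup (blocker B4, `11θ < 1`); U5 evaluates it exactly.  For a centred Gaussian process `X` (Mathlib `IsGaussianProcess`), legs `t : κ → T`,
two-point function `C`:
* `integral_prod_eight` — eight-point first-leg recursion (✓`GaussianWick.integral_mul_prod_eq_sum`); `integral_wick2_mul_six` — ONE Wick-ordered pair
  against six legs, `E[(X_bX_b' − C_bb')·X₁⋯X₆] = Σ_{i=1}^{6} E[X_bX_i]·E[X_b'·∏_{j≠i}X_j]` (no self-line of the pair, Glimm–Jaffe Cor. 8.3.2);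
* ★★ `integral_wick2_mul_cubic_mul_cubic` — for `B`, `B'` trace-free in each pair of slots,
  `E[(X_bX_b' − C_bb')·(Σ B_{ace}X_aX_cX_e)·(Σ B'_{a'c'e'}X_a'X_c'X_e')] = Σ_{ace a'c'e'} B B'·Σ_{i∈{a,c,e}, i'∈{a',c',e'}} (C_bi C_b'i' + C_bi' C_b'i)·(2 bipartite
  pairings of the other four)` — of the `6·15 = 90` monomials, the 54 with a line inside a triple die by the six trace conditions, 36 survive;
* ★ `integral_centredQuadForm_mul_cubic_mul_cubic` — the same summed against a coefficient matrix `L_bb'`.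
In the chart: `b, b'` = the two `Λ_T`-legs of `linCurvSq_T` (gradient lines, one into the `p₀`-triple, one into the `p'`-triple of `V₃`), the other four legs =
two propagators `p₀ ↔ p'`; summing `p'` gives RELATIVE `≲ H³·polylog/β` in place of B4's sup bound (chart transcription: next file / the assembler).
Mathlib + ✓`GaussianWickTheorem` / ✓`AllWindowsColdBoxCubicChaosSecondMoment` / ✓`QuadFormCum3Wick`; no definitions; standard axioms.  HONEST LABEL: a tool for
the RECORDED lift L2 of the NEXT rung U5 (⟨stmt-QuantumFields-24336⟩, UNSTAFFED); ⟨24004⟩ ⟨24336⟩ remain OPEN; route AllWindowsColdBox is DRAFT; no crux, rung or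
summit is proved; **the Yang–Mills mass gap is NOT proved by this file; no summit is proved by a line.**
-/

set_option autoImplicit false

noncomputable section

open MeasureTheory ProbabilityTheory Finset
open Literature.Probability.Distributions.GaussianWick
open Summit.QuantumFields.YangMills.Theorems.AllWindowsColdBox.CubicChaos (integrable_mul_six integral_mul_four integral_prod_six sum6_eq_sum_prod)

namespace Summit.QuantumFields.YangMills.Theorems.AllWindowsColdBoxBoxHighLine

namespace WickPairCubic

variable {T Ω : Type*} {mΩ : MeasurableSpace Ω} {P : Measure Ω} {X : T → Ω → ℝ}

/-! ## Eight legs -/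

/-- A product of eight coordinates of a Gaussian process is integrable. -/
theorem integrable_mul_eight (hX : IsGaussianProcess X P) (x₀ x₁ x₂ x₃ x₄ x₅ x₆ x₇ : T) :
    Integrable (fun ω => X x₀ ω * X x₁ ω * X x₂ ω * X x₃ ω * X x₄ ω * X x₅ ω * X x₆ ω * X x₇ ω) P := by
  have h := integrable_prod hX (Finset.univ : Finset (Fin 8)) ![x₀, x₁, x₂, x₃, x₄, x₅, x₆, x₇]
  refine h.congr (ae_of_all _ fun ω => ?_)
  simp only [Fin.prod_univ_eight]
  rfl

/-- **Eight-point first-leg recursion**: `E[X₀X₁⋯X₇] = Σ_{m=1}^{7} E[X₀X_m]·E[∏_{l≠0,m} X_l]`. -/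
theorem integral_prod_eight (hX : IsGaussianProcess X P) (h0 : ∀ t, ∫ ω, X t ω ∂P = 0) (x₀ x₁ x₂ x₃ x₄ x₅ x₆ x₇ : T) :
    ∫ ω, X x₀ ω * X x₁ ω * X x₂ ω * X x₃ ω * X x₄ ω * X x₅ ω * X x₆ ω * X x₇ ω ∂P =
      (∫ ω, X x₀ ω * X x₁ ω ∂P) * (∫ ω, X x₂ ω * X x₃ ω * X x₄ ω * X x₅ ω * X x₆ ω * X x₇ ω ∂P) +
      (∫ ω, X x₀ ω * X x₂ ω ∂P) * (∫ ω, X x₁ ω * X x₃ ω * X x₄ ω * X x₅ ω * X x₆ ω * X x₇ ω ∂P) +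
      (∫ ω, X x₀ ω * X x₃ ω ∂P) * (∫ ω, X x₁ ω * X x₂ ω * X x₄ ω * X x₅ ω * X x₆ ω * X x₇ ω ∂P) +
      (∫ ω, X x₀ ω * X x₄ ω ∂P) * (∫ ω, X x₁ ω * X x₂ ω * X x₃ ω * X x₅ ω * X x₆ ω * X x₇ ω ∂P) +
      (∫ ω, X x₀ ω * X x₅ ω ∂P) * (∫ ω, X x₁ ω * X x₂ ω * X x₃ ω * X x₄ ω * X x₆ ω * X x₇ ω ∂P) +
      (∫ ω, X x₀ ω * X x₆ ω ∂P) * (∫ ω, X x₁ ω * X x₂ ω * X x₃ ω * X x₄ ω * X x₅ ω * X x₇ ω ∂P) +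
      (∫ ω, X x₀ ω * X x₇ ω ∂P) * (∫ ω, X x₁ ω * X x₂ ω * X x₃ ω * X x₄ ω * X x₅ ω * X x₆ ω ∂P) := by
  classical
  set y : Fin 7 → T := ![x₁, x₂, x₃, x₄, x₅, x₆, x₇] with hy
  have hy0 : y 0 = x₁ := rfl; have hy1 : y 1 = x₂ := rfl; have hy2 : y 2 = x₃ := rfl; have hy3 : y 3 = x₄ := rfl
  have hy4 : y 4 = x₅ := rfl; have hy5 : y 5 = x₆ := rfl; have hy6 : y 6 = x₇ := rfl
  have h := integral_mul_prod_eq_sum hX h0 x₀ (Finset.univ : Finset (Fin 7)) y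
  have hl : ∀ ω, X x₀ ω * X x₁ ω * X x₂ ω * X x₃ ω * X x₄ ω * X x₅ ω * X x₆ ω * X x₇ ω = X x₀ ω * ∏ j : Fin 7, X (y j) ω :=
    fun ω => by
    rw [Fin.prod_univ_seven, hy0, hy1, hy2, hy3, hy4, hy5, hy6]
    ring
  simp_rw [hl]
  rw [h, Fin.sum_univ_seven]
  have e0 : ∀ f : Fin 7 → ℝ, ∏ i ∈ (Finset.univ : Finset (Fin 7)).erase 0, f i = f 1 * f 2 * f 3 * f 4 * f 5 * f 6 := fun f => by
    rw [show (Finset.univ : Finset (Fin 7)).erase 0 = {1, 2, 3, 4, 5, 6} by decide,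
      Finset.prod_insert (by decide), Finset.prod_insert (by decide), Finset.prod_insert (by decide),
      Finset.prod_insert (by decide), Finset.prod_pair (by decide)]; ring
  have e1 : ∀ f : Fin 7 → ℝ, ∏ i ∈ (Finset.univ : Finset (Fin 7)).erase 1, f i = f 0 * f 2 * f 3 * f 4 * f 5 * f 6 := fun f => by
    rw [show (Finset.univ : Finset (Fin 7)).erase 1 = {0, 2, 3, 4, 5, 6} by decide,
      Finset.prod_insert (by decide), Finset.prod_insert (by decide), Finset.prod_insert (by decide),
      Finset.prod_insert (by decide), Finset.prod_pair (by decide)]; ring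
  have e2 : ∀ f : Fin 7 → ℝ, ∏ i ∈ (Finset.univ : Finset (Fin 7)).erase 2, f i = f 0 * f 1 * f 3 * f 4 * f 5 * f 6 := fun f => by
    rw [show (Finset.univ : Finset (Fin 7)).erase 2 = {0, 1, 3, 4, 5, 6} by decide,
      Finset.prod_insert (by decide), Finset.prod_insert (by decide), Finset.prod_insert (by decide),
      Finset.prod_insert (by decide), Finset.prod_pair (by decide)]; ring
  have e3 : ∀ f : Fin 7 → ℝ, ∏ i ∈ (Finset.univ : Finset (Fin 7)).erase 3, f i = f 0 * f 1 * f 2 * f 4 * f 5 * f 6 := fun f => by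
    rw [show (Finset.univ : Finset (Fin 7)).erase 3 = {0, 1, 2, 4, 5, 6} by decide,
      Finset.prod_insert (by decide), Finset.prod_insert (by decide), Finset.prod_insert (by decide),
      Finset.prod_insert (by decide), Finset.prod_pair (by decide)]; ring
  have e4 : ∀ f : Fin 7 → ℝ, ∏ i ∈ (Finset.univ : Finset (Fin 7)).erase 4, f i = f 0 * f 1 * f 2 * f 3 * f 5 * f 6 := fun f => by
    rw [show (Finset.univ : Finset (Fin 7)).erase 4 = {0, 1, 2, 3, 5, 6} by decide,
      Finset.prod_insert (by decide), Finset.prod_insert (by decide), Finset.prod_insert (by decide),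
      Finset.prod_insert (by decide), Finset.prod_pair (by decide)]; ring
  have e5 : ∀ f : Fin 7 → ℝ, ∏ i ∈ (Finset.univ : Finset (Fin 7)).erase 5, f i = f 0 * f 1 * f 2 * f 3 * f 4 * f 6 := fun f => by
    rw [show (Finset.univ : Finset (Fin 7)).erase 5 = {0, 1, 2, 3, 4, 6} by decide,
      Finset.prod_insert (by decide), Finset.prod_insert (by decide), Finset.prod_insert (by decide),
      Finset.prod_insert (by decide), Finset.prod_pair (by decide)]; ring
  have e6 : ∀ f : Fin 7 → ℝ, ∏ i ∈ (Finset.univ : Finset (Fin 7)).erase 6, f i = f 0 * f 1 * f 2 * f 3 * f 4 * f 5 := fun f => by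
    rw [show (Finset.univ : Finset (Fin 7)).erase 6 = {0, 1, 2, 3, 4, 5} by decide,
      Finset.prod_insert (by decide), Finset.prod_insert (by decide), Finset.prod_insert (by decide),
      Finset.prod_insert (by decide), Finset.prod_pair (by decide)]; ring
  simp only [e0, e1, e2, e3, e4, e5, e6, hy0, hy1, hy2, hy3, hy4, hy5, hy6]

/-- The Wick-ordered pair against six legs is integrable. -/
theorem integrable_wick2_mul_six (hX : IsGaussianProcess X P) (b b' x₁ x₂ x₃ x₄ x₅ x₆ : T) :
    Integrable (fun ω => (X b ω * X b' ω - ∫ ω', X b ω' * X b' ω' ∂P) *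
      (X x₁ ω * X x₂ ω * X x₃ ω * X x₄ ω * X x₅ ω * X x₆ ω)) P := by
  have h8 := integrable_mul_eight hX b b' x₁ x₂ x₃ x₄ x₅ x₆
  have h6 := (integrable_mul_six hX x₁ x₂ x₃ x₄ x₅ x₆).const_mul (∫ ω', X b ω' * X b' ω' ∂P)
  refine (h8.sub h6).congr (ae_of_all _ fun ω => ?_)
  simp only [Pi.sub_apply]
  ring

/-- **One Wick-ordered pair against six legs**: `E[(X_bX_{b'} − C_{bb'})·X₁⋯X₆] = Σ_{i=1}^{6} E[X_bX_i]·E[X_{b'}∏_{j≠i}X_j]` (no self-line of the pair). -/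
theorem integral_wick2_mul_six (hX : IsGaussianProcess X P) (h0 : ∀ t, ∫ ω, X t ω ∂P = 0) (b b' x₁ x₂ x₃ x₄ x₅ x₆ : T) :
    ∫ ω, (X b ω * X b' ω - ∫ ω', X b ω' * X b' ω' ∂P) * (X x₁ ω * X x₂ ω * X x₃ ω * X x₄ ω * X x₅ ω * X x₆ ω) ∂P =
      (∫ ω, X b ω * X x₁ ω ∂P) * (∫ ω, X b' ω * X x₂ ω * X x₃ ω * X x₄ ω * X x₅ ω * X x₆ ω ∂P) +
      (∫ ω, X b ω * X x₂ ω ∂P) * (∫ ω, X b' ω * X x₁ ω * X x₃ ω * X x₄ ω * X x₅ ω * X x₆ ω ∂P) +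
      (∫ ω, X b ω * X x₃ ω ∂P) * (∫ ω, X b' ω * X x₁ ω * X x₂ ω * X x₄ ω * X x₅ ω * X x₆ ω ∂P) +
      (∫ ω, X b ω * X x₄ ω ∂P) * (∫ ω, X b' ω * X x₁ ω * X x₂ ω * X x₃ ω * X x₅ ω * X x₆ ω ∂P) +
      (∫ ω, X b ω * X x₅ ω ∂P) * (∫ ω, X b' ω * X x₁ ω * X x₂ ω * X x₃ ω * X x₄ ω * X x₆ ω ∂P) +
      (∫ ω, X b ω * X x₆ ω ∂P) * (∫ ω, X b' ω * X x₁ ω * X x₂ ω * X x₃ ω * X x₄ ω * X x₅ ω ∂P) := by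
  have hsplit : ∀ ω, (X b ω * X b' ω - ∫ ω', X b ω' * X b' ω' ∂P) * (X x₁ ω * X x₂ ω * X x₃ ω * X x₄ ω * X x₅ ω * X x₆ ω) =
      X b ω * X b' ω * X x₁ ω * X x₂ ω * X x₃ ω * X x₄ ω * X x₅ ω * X x₆ ω -
        (∫ ω', X b ω' * X b' ω' ∂P) * (X x₁ ω * X x₂ ω * X x₃ ω * X x₄ ω * X x₅ ω * X x₆ ω) := fun ω => by ring
  simp_rw [hsplit]
  rw [integral_sub (integrable_mul_eight hX _ _ _ _ _ _ _ _) ((integrable_mul_six hX _ _ _ _ _ _).const_mul _), integral_const_mul,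
    integral_prod_eight hX h0]
  ring

/-! ## Six-fold sums: bookkeeping and the six trace-free kills (two DIFFERENT tensors) -/

section Sums

variable {κ : Type*} [Fintype κ]

/-- `(Σ_{ace} f)(Σ_{a'c'e'} g) = Σ_{ace a'c'e'} f·g` (binders in this order). -/
theorem sum3_mul_sum3 (f g : κ → κ → κ → ℝ) :
    (∑ a, ∑ c, ∑ e, f a c e) * (∑ a', ∑ c', ∑ e', g a' c' e') = ∑ a, ∑ c, ∑ e, ∑ a', ∑ c', ∑ e', f a c e * g a' c' e' := by
  rw [Finset.sum_mul]; refine Finset.sum_congr rfl fun a _ => ?_; rw [Finset.sum_mul]; refine Finset.sum_congr rfl fun c _ => ?_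
  rw [Finset.sum_mul]; refine Finset.sum_congr rfl fun e _ => ?_; rw [Finset.mul_sum]; refine Finset.sum_congr rfl fun a' _ => ?_
  rw [Finset.mul_sum]; refine Finset.sum_congr rfl fun c' _ => ?_; rw [Finset.mul_sum]

/-- The inner triple sum factors out of a product term. -/
theorem sum3_inner_factor' (B B' : κ → κ → κ → ℝ) (u : κ → κ → κ → ℝ) (F : κ → κ → κ → κ → κ → κ → ℝ) (a c e : κ) :
    (∑ a', ∑ c', ∑ e', B a c e * B' a' c' e' * (u a c e * F a c e a' c' e')) =
      (B a c e * u a c e) * ∑ a', ∑ c', ∑ e', B' a' c' e' * F a c e a' c' e' := by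
  simp only [Finset.mul_sum]
  exact Finset.sum_congr rfl fun _ _ => Finset.sum_congr rfl fun _ _ => Finset.sum_congr rfl fun _ _ => by ring

/-- A line inside the first triple, legs `(c, e)`: killed by `Σ_{ce} B_{ace} C_{ce} = 0`. -/
theorem sum6_first23_eq_zero (B B' : κ → κ → κ → ℝ) (C : κ → κ → ℝ) (h : ∀ a, (∑ c, ∑ e, B a c e * C c e) = 0)
    (F : κ → κ → κ → κ → ℝ) :
    (∑ a, ∑ c, ∑ e, ∑ a', ∑ c', ∑ e', B a c e * B' a' c' e' * (C c e * F a a' c' e')) = 0 := by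
  have h1 : ∀ a c e, (∑ a', ∑ c', ∑ e', B a c e * B' a' c' e' * (C c e * F a a' c' e')) =
      (B a c e * C c e) * ∑ a', ∑ c', ∑ e', B' a' c' e' * F a a' c' e' := fun a c e =>
    sum3_inner_factor' B B' (fun _ c e => C c e) (fun a _ _ a' c' e' => F a a' c' e') a c e
  simp_rw [h1]
  refine Finset.sum_eq_zero fun a _ => ?_
  rw [show (∑ c, ∑ e, B a c e * C c e * ∑ a', ∑ c', ∑ e', B' a' c' e' * F a a' c' e') =
      (∑ c, ∑ e, B a c e * C c e) * ∑ a', ∑ c', ∑ e', B' a' c' e' * F a a' c' e' by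
    rw [Finset.sum_mul]; exact Finset.sum_congr rfl fun c _ => by rw [Finset.sum_mul]]
  rw [h a, zero_mul]

/-- A line inside the first triple, legs `(a, e)`: killed by `Σ_{ae} B_{ace} C_{ae} = 0`. -/
theorem sum6_first13_eq_zero (B B' : κ → κ → κ → ℝ) (C : κ → κ → ℝ) (h : ∀ c, (∑ a, ∑ e, B a c e * C a e) = 0)
    (F : κ → κ → κ → κ → ℝ) :
    (∑ a, ∑ c, ∑ e, ∑ a', ∑ c', ∑ e', B a c e * B' a' c' e' * (C a e * F c a' c' e')) = 0 := by
  have h1 : ∀ a c e, (∑ a', ∑ c', ∑ e', B a c e * B' a' c' e' * (C a e * F c a' c' e')) =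
      (B a c e * C a e) * ∑ a', ∑ c', ∑ e', B' a' c' e' * F c a' c' e' := fun a c e =>
    sum3_inner_factor' B B' (fun a _ e => C a e) (fun _ c _ a' c' e' => F c a' c' e') a c e
  simp_rw [h1]
  rw [Finset.sum_comm]
  refine Finset.sum_eq_zero fun c _ => ?_
  rw [show (∑ a, ∑ e, B a c e * C a e * ∑ a', ∑ c', ∑ e', B' a' c' e' * F c a' c' e') =
      (∑ a, ∑ e, B a c e * C a e) * ∑ a', ∑ c', ∑ e', B' a' c' e' * F c a' c' e' by
    rw [Finset.sum_mul]; exact Finset.sum_congr rfl fun a _ => by rw [Finset.sum_mul]]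
  rw [h c, zero_mul]

/-- A line inside the first triple, legs `(a, c)`: killed by `Σ_{ac} B_{ace} C_{ac} = 0`. -/
theorem sum6_first12_eq_zero (B B' : κ → κ → κ → ℝ) (C : κ → κ → ℝ) (h : ∀ e, (∑ a, ∑ c, B a c e * C a c) = 0)
    (F : κ → κ → κ → κ → ℝ) :
    (∑ a, ∑ c, ∑ e, ∑ a', ∑ c', ∑ e', B a c e * B' a' c' e' * (C a c * F e a' c' e')) = 0 := by
  have h1 : ∀ a c e, (∑ a', ∑ c', ∑ e', B a c e * B' a' c' e' * (C a c * F e a' c' e')) =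
      (B a c e * C a c) * ∑ a', ∑ c', ∑ e', B' a' c' e' * F e a' c' e' := fun a c e =>
    sum3_inner_factor' B B' (fun a c _ => C a c) (fun _ _ e a' c' e' => F e a' c' e') a c e
  simp_rw [h1]
  rw [Summit.QuantumFields.YangMills.Theorems.AllWindowsColdBox.CubicChaos.sum3_rotate]
  refine Finset.sum_eq_zero fun e _ => ?_
  rw [show (∑ a, ∑ c, B a c e * C a c * ∑ a', ∑ c', ∑ e', B' a' c' e' * F e a' c' e') =
      (∑ a, ∑ c, B a c e * C a c) * ∑ a', ∑ c', ∑ e', B' a' c' e' * F e a' c' e' by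
    rw [Finset.sum_mul]; exact Finset.sum_congr rfl fun a _ => by rw [Finset.sum_mul]]
  rw [h e, zero_mul]

/-- The inner triple sum with a line inside the SECOND triple vanishes, legs `(c', e')`. -/
theorem sum3_second23_eq_zero (B' : κ → κ → κ → ℝ) (C : κ → κ → ℝ) (h : ∀ a', (∑ c', ∑ e', B' a' c' e' * C c' e') = 0) (G : κ → ℝ) :
    (∑ a', ∑ c', ∑ e', B' a' c' e' * (C c' e' * G a')) = 0 := by
  refine Finset.sum_eq_zero fun a' _ => ?_
  rw [show (∑ c', ∑ e', B' a' c' e' * (C c' e' * G a')) = (∑ c', ∑ e', B' a' c' e' * C c' e') * G a' by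
    rw [Finset.sum_mul]; exact Finset.sum_congr rfl fun c' _ => by
      rw [Finset.sum_mul]; exact Finset.sum_congr rfl fun e' _ => by ring]
  rw [h a', zero_mul]

/-- The inner triple sum with a line inside the SECOND triple vanishes, legs `(a', e')`. -/
theorem sum3_second13_eq_zero (B' : κ → κ → κ → ℝ) (C : κ → κ → ℝ) (h : ∀ c', (∑ a', ∑ e', B' a' c' e' * C a' e') = 0) (G : κ → ℝ) :
    (∑ a', ∑ c', ∑ e', B' a' c' e' * (C a' e' * G c')) = 0 := by
  rw [Finset.sum_comm]
  refine Finset.sum_eq_zero fun c' _ => ?_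
  rw [show (∑ a', ∑ e', B' a' c' e' * (C a' e' * G c')) = (∑ a', ∑ e', B' a' c' e' * C a' e') * G c' by
    rw [Finset.sum_mul]; exact Finset.sum_congr rfl fun a' _ => by
      rw [Finset.sum_mul]; exact Finset.sum_congr rfl fun e' _ => by ring]
  rw [h c', zero_mul]

/-- The inner triple sum with a line inside the SECOND triple vanishes, legs `(a', c')`. -/
theorem sum3_second12_eq_zero (B' : κ → κ → κ → ℝ) (C : κ → κ → ℝ) (h : ∀ e', (∑ a', ∑ c', B' a' c' e' * C a' c') = 0) (G : κ → ℝ) :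
    (∑ a', ∑ c', ∑ e', B' a' c' e' * (C a' c' * G e')) = 0 := by
  rw [Summit.QuantumFields.YangMills.Theorems.AllWindowsColdBox.CubicChaos.sum3_rotate]
  refine Finset.sum_eq_zero fun e' _ => ?_
  rw [show (∑ a', ∑ c', B' a' c' e' * (C a' c' * G e')) = (∑ a', ∑ c', B' a' c' e' * C a' c') * G e' by
    rw [Finset.sum_mul]; exact Finset.sum_congr rfl fun a' _ => by
      rw [Finset.sum_mul]; exact Finset.sum_congr rfl fun c' _ => by ring]
  rw [h e', zero_mul]

/-- A line inside the second triple kills the six-fold sum (any of the three pairs; `F` depends on the first triple and the free second leg). -/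
theorem sum6_second_eq_zero (B B' : κ → κ → κ → ℝ) (u : κ → κ → κ → ℝ) (F : κ → κ → κ → κ → κ → κ → ℝ)
    (h : ∀ a c e, (∑ a', ∑ c', ∑ e', B' a' c' e' * (u a' c' e' * F a c e a' c' e')) = 0) :
    (∑ a, ∑ c, ∑ e, ∑ a', ∑ c', ∑ e', B a c e * B' a' c' e' * (u a' c' e' * F a c e a' c' e')) = 0 := by
  refine Finset.sum_eq_zero fun a _ => Finset.sum_eq_zero fun c _ => Finset.sum_eq_zero fun e _ => ?_
  rw [show (∑ a', ∑ c', ∑ e', B a c e * B' a' c' e' * (u a' c' e' * F a c e a' c' e')) =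
      B a c e * ∑ a', ∑ c', ∑ e', B' a' c' e' * (u a' c' e' * F a c e a' c' e') by
    rw [Finset.mul_sum]; exact Finset.sum_congr rfl fun a' _ => by
      rw [Finset.mul_sum]; exact Finset.sum_congr rfl fun c' _ => by
        rw [Finset.mul_sum]; exact Finset.sum_congr rfl fun e' _ => by ring]
  rw [h a c e, mul_zero]

end Sums

/-! ## One Wick-ordered pair against two trace-free cubic forms -/

section Main

variable {κ : Type*} [Fintype κ]

/-- ★★ **One Wick-ordered pair against two trace-free cubic forms**: only the 36 pairings whose pair legs land in different triples and whose
remaining four legs are paired across the triples survive. -/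
theorem integral_wick2_mul_cubic_mul_cubic (hX : IsGaussianProcess X P) (h0 : ∀ s, ∫ ω, X s ω ∂P = 0) (t : κ → T) (C : κ → κ → ℝ)
    (hC : ∀ a b, C a b = ∫ ω, X (t a) ω * X (t b) ω ∂P) (B B' : κ → κ → κ → ℝ)
    (hB12 : ∀ e, (∑ a, ∑ c, B a c e * C a c) = 0) (hB13 : ∀ c, (∑ a, ∑ e, B a c e * C a e) = 0)
    (hB23 : ∀ a, (∑ c, ∑ e, B a c e * C c e) = 0)
    (hB'12 : ∀ e', (∑ a', ∑ c', B' a' c' e' * C a' c') = 0) (hB'13 : ∀ c', (∑ a', ∑ e', B' a' c' e' * C a' e') = 0)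
    (hB'23 : ∀ a', (∑ c', ∑ e', B' a' c' e' * C c' e') = 0)
    {PB PB' : Ω → ℝ} (hPB : ∀ ω, PB ω = ∑ a, ∑ c, ∑ e, B a c e * (X (t a) ω * X (t c) ω * X (t e) ω))
    (hPB' : ∀ ω, PB' ω = ∑ a', ∑ c', ∑ e', B' a' c' e' * (X (t a') ω * X (t c') ω * X (t e') ω)) (b b' : κ) :
    ∫ ω, (X (t b) ω * X (t b') ω - C b b') * PB ω * PB' ω ∂P =
      ∑ a, ∑ c, ∑ e, ∑ a', ∑ c', ∑ e', B a c e * B' a' c' e' *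
        ((C b a * C b' a' + C b a' * C b' a) * (C c c' * C e e' + C c e' * C e c') +
         (C b a * C b' c' + C b c' * C b' a) * (C c a' * C e e' + C c e' * C e a') +
         (C b a * C b' e' + C b e' * C b' a) * (C c a' * C e c' + C c c' * C e a') +
         (C b c * C b' a' + C b a' * C b' c) * (C a c' * C e e' + C a e' * C e c') +
         (C b c * C b' c' + C b c' * C b' c) * (C a a' * C e e' + C a e' * C e a') +
         (C b c * C b' e' + C b e' * C b' c) * (C a a' * C e c' + C a c' * C e a') +
         (C b e * C b' a' + C b a' * C b' e) * (C a c' * C c e' + C a e' * C c c') +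
         (C b e * C b' c' + C b c' * C b' e) * (C a a' * C c e' + C a e' * C c a') +
         (C b e * C b' e' + C b e' * C b' e) * (C a a' * C c c' + C a c' * C c a')) := by
  classical
  -- Step A: pointwise expansion
  have hprod : ∀ ω, (X (t b) ω * X (t b') ω - C b b') * PB ω * PB' ω = ∑ a, ∑ c, ∑ e, ∑ a', ∑ c', ∑ e', B a c e * B' a' c' e' *
        ((X (t b) ω * X (t b') ω - ∫ ω', X (t b) ω' * X (t b') ω' ∂P) * (X (t a) ω * X (t c) ω * X (t e) ω * X (t a') ω * X (t c') ω * X (t e') ω)) := by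
    intro ω
    rw [hPB ω, hPB' ω, mul_assoc, sum3_mul_sum3, Finset.mul_sum]
    refine Finset.sum_congr rfl fun a _ => ?_; rw [Finset.mul_sum]; refine Finset.sum_congr rfl fun c _ => ?_
    rw [Finset.mul_sum]; refine Finset.sum_congr rfl fun e _ => ?_; rw [Finset.mul_sum]; refine Finset.sum_congr rfl fun a' _ => ?_
    rw [Finset.mul_sum]; refine Finset.sum_congr rfl fun c' _ => ?_; rw [Finset.mul_sum]; refine Finset.sum_congr rfl fun e' _ => ?_
    rw [← hC]; ring
  simp_rw [hprod]
  -- Step B: integrate termwise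
  have hint : ∀ a c e a' c' e', Integrable (fun ω => B a c e * B' a' c' e' *
      ((X (t b) ω * X (t b') ω - ∫ ω', X (t b) ω' * X (t b') ω' ∂P) * (X (t a) ω * X (t c) ω * X (t e) ω * X (t a') ω * X (t c') ω * X (t e') ω))) P :=
    fun a c e a' c' e' => (integrable_wick2_mul_six hX _ _ _ _ _ _ _ _).const_mul _
  have hswap : ∫ ω, ∑ a, ∑ c, ∑ e, ∑ a', ∑ c', ∑ e', B a c e * B' a' c' e' * ((X (t b) ω * X (t b') ω - ∫ ω', X (t b) ω' * X (t b') ω' ∂P) *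
          (X (t a) ω * X (t c) ω * X (t e) ω * X (t a') ω * X (t c') ω * X (t e') ω)) ∂P =
      ∑ a, ∑ c, ∑ e, ∑ a', ∑ c', ∑ e', ∫ ω, B a c e * B' a' c' e' * ((X (t b) ω * X (t b') ω - ∫ ω', X (t b) ω' * X (t b') ω' ∂P) *
          (X (t a) ω * X (t c) ω * X (t e) ω * X (t a') ω * X (t c') ω * X (t e') ω)) ∂P := by
    simp_rw [sum6_eq_sum_prod]; rw [integral_finsetSum _ fun z _ => hint _ _ _ _ _ _]
  rw [hswap]
  -- Step C: each term by `integral_wick2_mul_six`, `integral_prod_six`, `integral_mul_four`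
  have h8 : ∀ a c e a' c' e', ∫ ω, B a c e * B' a' c' e' * ((X (t b) ω * X (t b') ω - ∫ ω', X (t b) ω' * X (t b') ω' ∂P) *
          (X (t a) ω * X (t c) ω * X (t e) ω * X (t a') ω * X (t c') ω * X (t e') ω)) ∂P =
      B a c e * B' a' c' e' * ((C b a * C b' a' + C b a' * C b' a) * (C c c' * C e e' + C c e' * C e c') +
         (C b a * C b' c' + C b c' * C b' a) * (C c a' * C e e' + C c e' * C e a') +
         (C b a * C b' e' + C b e' * C b' a) * (C c a' * C e c' + C c c' * C e a') +
         (C b c * C b' a' + C b a' * C b' c) * (C a c' * C e e' + C a e' * C e c') +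
         (C b c * C b' c' + C b c' * C b' c) * (C a a' * C e e' + C a e' * C e a') +
         (C b c * C b' e' + C b e' * C b' c) * (C a a' * C e c' + C a c' * C e a') +
         (C b e * C b' a' + C b a' * C b' e) * (C a c' * C c e' + C a e' * C c c') +
         (C b e * C b' c' + C b c' * C b' e) * (C a a' * C c e' + C a e' * C c a') +
         (C b e * C b' e' + C b e' * C b' e) * (C a a' * C c c' + C a c' * C c a')) +
        B a c e * B' a' c' e' * (C a c *
          (C b e * C b' a' * C c' e' + C b e * C b' c' * C a' e' + C b e * C b' e' * C a' c' + C b a' * C b' e * C c' e' + C b a' * C b' c' * C e e' + C b a' * C b' e' * C e c' +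
            C b c' * C b' e * C a' e' + C b c' * C b' a' * C e e' + C b c' * C b' e' * C e a' + C b e' * C b' e * C a' c' + C b e' * C b' a' * C e c' + C b e' * C b' c' * C e a')) +
        B a c e * B' a' c' e' * (C a e *
          (C b c * C b' a' * C c' e' + C b c * C b' c' * C a' e' + C b c * C b' e' * C a' c' + C b a' * C b' c * C c' e' + C b a' * C b' c' * C c e' + C b a' * C b' e' * C c c' +
            C b c' * C b' c * C a' e' + C b c' * C b' a' * C c e' + C b c' * C b' e' * C c a' + C b e' * C b' c * C a' c' + C b e' * C b' a' * C c c' + C b e' * C b' c' * C c a')) +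
        B a c e * B' a' c' e' * (C c e *
          (C b a * C b' a' * C c' e' + C b a * C b' c' * C a' e' + C b a * C b' e' * C a' c' + C b a' * C b' a * C c' e' + C b a' * C b' c' * C a e' + C b a' * C b' e' * C a c' +
            C b c' * C b' a * C a' e' + C b c' * C b' a' * C a e' + C b c' * C b' e' * C a a' + C b e' * C b' a * C a' c' + C b e' * C b' a' * C a c' + C b e' * C b' c' * C a a')) +
        B a c e * B' a' c' e' * (C a' c' *
          (C b a * C b' c * C e e' + C b a * C b' e * C c e' + C b c * C b' a * C e e' + C b c * C b' e * C a e' + C b e * C b' a * C c e' + C b e * C b' c * C a e')) +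
        B a c e * B' a' c' e' * (C a' e' *
          (C b a * C b' c * C e c' + C b a * C b' e * C c c' + C b c * C b' a * C e c' + C b c * C b' e * C a c' + C b e * C b' a * C c c' + C b e * C b' c * C a c')) +
        B a c e * B' a' c' e' * (C c' e' *
          (C b a * C b' c * C e a' + C b a * C b' e * C c a' + C b c * C b' a * C e a' + C b c * C b' e * C a a' + C b e * C b' a * C c a' + C b e * C b' c * C a a')) := by
    intro a c e a' c' e'
    rw [integral_const_mul, integral_wick2_mul_six hX h0]
    simp only [integral_prod_six hX h0, integral_mul_four hX h0, ← hC]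
    ring
  rw [QuadCum3.sum6_congr h8]
  simp (config := { maxSteps := 4000000 }) only [Finset.sum_add_distrib]
  rw [sum6_first12_eq_zero B B' C hB12 (fun e a' c' e' =>
          C b e * C b' a' * C c' e' + C b e * C b' c' * C a' e' + C b e * C b' e' * C a' c' + C b a' * C b' e * C c' e' + C b a' * C b' c' * C e e' + C b a' * C b' e' * C e c' +
            C b c' * C b' e * C a' e' + C b c' * C b' a' * C e e' + C b c' * C b' e' * C e a' + C b e' * C b' e * C a' c' + C b e' * C b' a' * C e c' + C b e' * C b' c' * C e a'),
    sum6_first13_eq_zero B B' C hB13 (fun c a' c' e' =>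
          C b c * C b' a' * C c' e' + C b c * C b' c' * C a' e' + C b c * C b' e' * C a' c' + C b a' * C b' c * C c' e' + C b a' * C b' c' * C c e' + C b a' * C b' e' * C c c' +
            C b c' * C b' c * C a' e' + C b c' * C b' a' * C c e' + C b c' * C b' e' * C c a' + C b e' * C b' c * C a' c' + C b e' * C b' a' * C c c' + C b e' * C b' c' * C c a'),
    sum6_first23_eq_zero B B' C hB23 (fun a a' c' e' =>
          C b a * C b' a' * C c' e' + C b a * C b' c' * C a' e' + C b a * C b' e' * C a' c' + C b a' * C b' a * C c' e' + C b a' * C b' c' * C a e' + C b a' * C b' e' * C a c' +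
            C b c' * C b' a * C a' e' + C b c' * C b' a' * C a e' + C b c' * C b' e' * C a a' + C b e' * C b' a * C a' c' + C b e' * C b' a' * C a c' + C b e' * C b' c' * C a a'),
    sum6_second_eq_zero B B' (fun a' c' _ => C a' c') (fun a c e a' c' e' =>
          C b a * C b' c * C e e' + C b a * C b' e * C c e' + C b c * C b' a * C e e' + C b c * C b' e * C a e' + C b e * C b' a * C c e' + C b e * C b' c * C a e')
      (fun a c e => sum3_second12_eq_zero B' C hB'12 _),
    sum6_second_eq_zero B B' (fun a' _ e' => C a' e') (fun a c e a' c' e' =>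
          C b a * C b' c * C e c' + C b a * C b' e * C c c' + C b c * C b' a * C e c' + C b c * C b' e * C a c' + C b e * C b' a * C c c' + C b e * C b' c * C a c')
      (fun a c e => sum3_second13_eq_zero B' C hB'13 _),
    sum6_second_eq_zero B B' (fun _ c' e' => C c' e') (fun a c e a' c' e' =>
          C b a * C b' c * C e a' + C b a * C b' e * C c a' + C b c * C b' a * C e a' + C b c * C b' e * C a a' + C b e * C b' a * C c a' + C b e * C b' c * C a a')
      (fun a c e => sum3_second23_eq_zero B' C hB'23 _)]
  simp only [add_zero]

/-- The centred quadratic form `Σ_{bb'} L_{bb'}(X_bX_{b'} − C_{bb'})` against the two cubic forms is integrable term by term. -/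
theorem integrable_coeff_wick2_mul_cubic_mul_cubic (hX : IsGaussianProcess X P) (t : κ → T) (C : κ → κ → ℝ)
    (hC : ∀ a b, C a b = ∫ ω, X (t a) ω * X (t b) ω ∂P) (B B' : κ → κ → κ → ℝ)
    {PB PB' : Ω → ℝ} (hPB : ∀ ω, PB ω = ∑ a, ∑ c, ∑ e, B a c e * (X (t a) ω * X (t c) ω * X (t e) ω))
    (hPB' : ∀ ω, PB' ω = ∑ a', ∑ c', ∑ e', B' a' c' e' * (X (t a') ω * X (t c') ω * X (t e') ω)) (L : κ → κ → ℝ) (b b' : κ) :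
    Integrable (fun ω => L b b' * (X (t b) ω * X (t b') ω - C b b') * PB ω * PB' ω) P := by
  classical
  have hprod : ∀ ω, L b b' * (X (t b) ω * X (t b') ω - C b b') * PB ω * PB' ω = ∑ a, ∑ c, ∑ e, ∑ a', ∑ c', ∑ e', L b b' * B a c e * B' a' c' e' *
        ((X (t b) ω * X (t b') ω - ∫ ω', X (t b) ω' * X (t b') ω' ∂P) * (X (t a) ω * X (t c) ω * X (t e) ω * X (t a') ω * X (t c') ω * X (t e') ω)) := by
    intro ω
    rw [hPB ω, hPB' ω, mul_assoc, sum3_mul_sum3, Finset.mul_sum]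
    refine Finset.sum_congr rfl fun a _ => ?_; rw [Finset.mul_sum]; refine Finset.sum_congr rfl fun c _ => ?_
    rw [Finset.mul_sum]; refine Finset.sum_congr rfl fun e _ => ?_; rw [Finset.mul_sum]; refine Finset.sum_congr rfl fun a' _ => ?_
    rw [Finset.mul_sum]; refine Finset.sum_congr rfl fun c' _ => ?_; rw [Finset.mul_sum]; refine Finset.sum_congr rfl fun e' _ => ?_
    rw [← hC]; ring
  simp_rw [hprod, sum6_eq_sum_prod]
  exact integrable_finsetSum _ fun z _ => (integrable_wick2_mul_six hX _ _ _ _ _ _ _ _).const_mul _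

/-- ★ **The centred quadratic form against two trace-free cubic forms**: `E[(Σ_{bb'} L_{bb'}(X_bX_{b'} − C_{bb'}))·P_B·P_{B'}]` is `Σ_{bb'} L_{bb'}`
times the 36 connected pairings of `integral_wick2_mul_cubic_mul_cubic`. -/
theorem integral_centredQuadForm_mul_cubic_mul_cubic (hX : IsGaussianProcess X P) (h0 : ∀ s, ∫ ω, X s ω ∂P = 0) (t : κ → T)
    (C : κ → κ → ℝ) (hC : ∀ a b, C a b = ∫ ω, X (t a) ω * X (t b) ω ∂P) (B B' : κ → κ → κ → ℝ)
    (hB12 : ∀ e, (∑ a, ∑ c, B a c e * C a c) = 0) (hB13 : ∀ c, (∑ a, ∑ e, B a c e * C a e) = 0)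
    (hB23 : ∀ a, (∑ c, ∑ e, B a c e * C c e) = 0)
    (hB'12 : ∀ e', (∑ a', ∑ c', B' a' c' e' * C a' c') = 0) (hB'13 : ∀ c', (∑ a', ∑ e', B' a' c' e' * C a' e') = 0)
    (hB'23 : ∀ a', (∑ c', ∑ e', B' a' c' e' * C c' e') = 0)
    {PB PB' : Ω → ℝ} (hPB : ∀ ω, PB ω = ∑ a, ∑ c, ∑ e, B a c e * (X (t a) ω * X (t c) ω * X (t e) ω))
    (hPB' : ∀ ω, PB' ω = ∑ a', ∑ c', ∑ e', B' a' c' e' * (X (t a') ω * X (t c') ω * X (t e') ω)) (L : κ → κ → ℝ)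
    {QL : Ω → ℝ} (hQL : ∀ ω, QL ω = ∑ b, ∑ b', L b b' * (X (t b) ω * X (t b') ω - C b b')) :
    ∫ ω, QL ω * PB ω * PB' ω ∂P =
      ∑ b, ∑ b', L b b' * ∑ a, ∑ c, ∑ e, ∑ a', ∑ c', ∑ e', B a c e * B' a' c' e' *
        ((C b a * C b' a' + C b a' * C b' a) * (C c c' * C e e' + C c e' * C e c') +
         (C b a * C b' c' + C b c' * C b' a) * (C c a' * C e e' + C c e' * C e a') +
         (C b a * C b' e' + C b e' * C b' a) * (C c a' * C e c' + C c c' * C e a') +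
         (C b c * C b' a' + C b a' * C b' c) * (C a c' * C e e' + C a e' * C e c') +
         (C b c * C b' c' + C b c' * C b' c) * (C a a' * C e e' + C a e' * C e a') +
         (C b c * C b' e' + C b e' * C b' c) * (C a a' * C e c' + C a c' * C e a') +
         (C b e * C b' a' + C b a' * C b' e) * (C a c' * C c e' + C a e' * C c c') +
         (C b e * C b' c' + C b c' * C b' e) * (C a a' * C c e' + C a e' * C c a') +
         (C b e * C b' e' + C b e' * C b' e) * (C a a' * C c c' + C a c' * C c a')) := by
  classical
  have hsum : ∀ ω, QL ω * PB ω * PB' ω = ∑ b, ∑ b', L b b' * (X (t b) ω * X (t b') ω - C b b') * PB ω * PB' ω := by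
    intro ω
    rw [hQL ω, Finset.sum_mul, Finset.sum_mul]
    refine Finset.sum_congr rfl fun b _ => ?_
    rw [Finset.sum_mul, Finset.sum_mul]
  simp_rw [hsum]
  rw [integral_finsetSum _ fun b _ => integrable_finsetSum _ fun b' _ =>
    integrable_coeff_wick2_mul_cubic_mul_cubic hX t C hC B B' hPB hPB' L b b']
  refine Finset.sum_congr rfl fun b _ => ?_
  rw [integral_finsetSum _ fun b' _ => integrable_coeff_wick2_mul_cubic_mul_cubic hX t C hC B B' hPB hPB' L b b']
  refine Finset.sum_congr rfl fun b' _ => ?_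
  have hc : ∀ ω, L b b' * (X (t b) ω * X (t b') ω - C b b') * PB ω * PB' ω =
      L b b' * ((X (t b) ω * X (t b') ω - C b b') * PB ω * PB' ω) := fun ω => by ring
  simp_rw [hc]
  rw [integral_const_mul, integral_wick2_mul_cubic_mul_cubic hX h0 t C hC B B' hB12 hB13 hB23 hB'12 hB'13 hB'23 hPB hPB' b b']

end Main

end WickPairCubic

end Summit.QuantumFields.YangMills.Theorems.AllWindowsColdBoxBoxHighLine

end
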